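import Literature.MathematicalPhysics.QuantumLattice.HubbardNNNHoppingTorusLimitCorrelator
import HarnessLib

/-!
# `t–t'` Hubbard model: correlator window certificates that use BOTH edges of a certified energy window
# (`lo ≤ e₀ ≤ hi`) bound the correlators of torus-limit ground states — the signed-slack edge

Family `hubbard` (topic `MathematicalPhysics/QuantumLattice`). Wang et al. (PRX 14 (2024) 031006, §III
eq. (obsopt)) bound a ground-state expectation value `⟨O⟩` by optimising over a relaxation of the
state set cut by TWO energy half-spaces: `⟨E_up − H⟩ ≥ 0` (a variational / certified UPPER bound on
the ground-state energy) AND `⟨H − E_low⟩ ≥ 0` (a certified LOWER bound obtained from a possibly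
different, larger relaxation) — "these two bounds also have a polynomial form … and can be added as
additional constraints". The tree's thermodynamic-limit soundness theorem
`InfVolFermionState.IsTorusLimitOf.re_sum_expect_d4_ge_of_window_certificate_TT'_ineq`
(`HubbardNNNHoppingTorusLimitCorrelator`) implements the FIRST half only: one energy term
`κ (u·1 − Γ E^{tt'}_Φ)` with `κ ≥ 0` and the hypothesis `energyDensityTT' t t' U n ≤ u`. This file adds
the second half without touching the certificate FORMAT:

* `…re_sum_expect_d4_ge_of_window_certificate_TT'_ineq_of_slack` — the same window identity, the
  same conclusion `c − Σₖ ‖aₖ‖ + (Σ_σ μ_σ)(n/2 − ν) ≤ |S|⁻¹ Σ_{γ∈S} Re ω_{γΛ'}(Γ(d4Emb γ 0) X)`, under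
  the SIGNED-SLACK hypothesis `0 ≤ κ (u − energyDensityTT' t t' U n)` in place of `κ ≥ 0 ∧ e ≤ u`
  (so `κ ≤ 0` with a certified LOWER bound `u ≤ e` is admitted). Proof: the tree's limit passage
  verbatim (finite-torus signed inequality `re_orbitState_ge_of_window_certificate_d4_TT'_ineq`, the
  dictionary `re_orbitState_spaceGroupUnitary_fermionEmbed_toTorusEmb`, `E_L/L² → energyDensityTT'`,
  `rectN n L / L² → n`), the limit slack being dropped by the new hypothesis;
* `…re_expect_ge_of_window_certificate_TT'_ineq_of_slack` — translation-only certificates (`γₗ = 1`):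
  `… ≤ Re ω_{Λ'}(X)`;
* `…re_sum_expect_d4_ge_of_window_certificate_TT'_ineq_of_window` and
  `…re_expect_ge_of_window_certificate_TT'_ineq_of_window` — the TWO-MULTIPLIER form as printed: a
  window identity with energy terms `κ₊ (hi·1 − Γ E_Φ) + κ₋ (Γ E_Φ − lo·1)`, `κ₊, κ₋ ≥ 0`, and a
  certified window `lo ≤ energyDensityTT' t t' U n ≤ hi` give the same conclusion. Reduction: the two
  terms collapse to ONE signed term `κ (u·1 − Γ E_Φ)` with `κ = κ₊ − κ₋`, `κ u = κ₊ hi − κ₋ lo` (plus a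
  nonnegative constant `κ₊ (hi − lo)` absorbed into `c` when `κ₊ = κ₋`), whose slack
  `κ (u − e) = κ₊ (hi − e) + κ₋ (e − lo)` is nonnegative on the window (`smul_window_collapse`).

Use (venture CertifiedManyBodySolver, crew hubbard-obs): every certified LOWER energy row of the
`(U, n, t') = (8, 7/8, 0)` cell (the cell's main product) becomes a legal constraint of a correlator /
pair-correlator certificate, not only the certified upper row. HONEST SCOPE: soundness edge only; no
number, no claim on the Hubbard ground state; the `D₄` orbit-mean caveat of the parent file is unchanged.
Everything is PROVED; no definition, no named fact.

## References
* J. Wang, J. Surace, I. Frérot, B. Legat, M.-O. Renou, V. Magron, A. Acín, *Certifying ground-state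
  properties of many-body systems*, Phys. Rev. X 14 (2024) 031006, §III eq. (obsopt) (both energy
  half-spaces as constraints). [cite: WangEtAl2024, §III]
* X. Han, *Quantum many-body bootstrap*, arXiv:2006.06002 (2020), §3. [cite: Han2020Bootstrap, §3]
* O. Bratteli, D. W. Robinson, *Operator Algebras and Quantum Statistical Mechanics II*, §6.2.4.
  [cite: BratteliRobinsonII1997, §6.2.4]
-/

noncomputable section

namespace Literature.MathematicalPhysics.QuantumLattice

open Matrix Finset HubbardWave0 Literature.Probability.LatticeModels
open Literature.MathematicalPhysics.QuantumManyBody.StateRelaxation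
open _root_.Filter
open scoped ComplexOrder BigOperators _root_.Topology

/-! ### Two small facts re-proved here (private in the parent file) -/

section Aux

/-- Half the sector particle number `rectN n L = 2⌊nL²/2⌋` is at most the number of sites of the torus
(`0 ≤ n ≤ 2`). [folklore] -/
private theorem half_rectN_le_card_fermionTorus {n : ℝ} (hn0 : 0 ≤ n) (hn2 : n ≤ 2) (L : ℕ) :
    ⌊n * (L : ℝ) ^ 2 / 2⌋₊ ≤ Fintype.card (FermionTorus 2 L) := by
  have h := ThermodynamicLimit.rectN_le_two_mul hn0 hn2 L
  have hrect : ThermodynamicLimit.rectN n L = 2 * ⌊n * (L : ℝ) ^ 2 / 2⌋₊ := rfl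
  rw [hrect, ← sq] at h
  have hcard : Fintype.card (FermionTorus 2 L) = L ^ 2 := by simp [FermionTorus]
  rw [hcard]
  exact Nat.le_of_mul_le_mul_left h two_pos

/-- **Collapse of the two energy half-space terms to one signed term.** In any `ℂ`-module with a
distinguished vector `one`, for real `κ₊, κ₋, hi, lo` with `κ₊ ≠ κ₋`, setting `κ = κ₊ − κ₋` and
`u = (κ₊ hi − κ₋ lo)/κ`:
`κ • (u • one − E) = κ₊ • (hi • one − E) + κ₋ • (E − lo • one)`. [cite: WangEtAl2024, §III] -/
theorem smul_window_collapse {M : Type*} [AddCommGroup M] [Module ℂ M] (one E : M)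
    {κp κm : ℝ} (hi lo : ℝ) (hne : κp ≠ κm) :
    (((κp - κm : ℝ)) : ℂ) • (((((κp * hi - κm * lo) / (κp - κm) : ℝ)) : ℂ) • one - E) =
      ((κp : ℝ) : ℂ) • (((hi : ℝ) : ℂ) • one - E) + ((κm : ℝ) : ℂ) • (E - ((lo : ℝ) : ℂ) • one) := by
  have hκ : κp - κm ≠ 0 := sub_ne_zero.2 hne
  rw [smul_sub, smul_smul, ← Complex.ofReal_mul, mul_div_cancel₀ _ hκ]
  push_cast
  module

/-- The slack of the collapsed term is the sum of the two nonnegative slacks: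
`κ (u − e) = κ₊ (hi − e) + κ₋ (e − lo)`. [cite: WangEtAl2024, §III] -/
theorem window_collapse_slack {κp κm : ℝ} (hi lo e : ℝ) (hne : κp ≠ κm) :
    (κp - κm) * ((κp * hi - κm * lo) / (κp - κm) - e) = κp * (hi - e) + κm * (e - lo) := by
  have hκ : κp - κm ≠ 0 := sub_ne_zero.2 hne
  rw [mul_sub, mul_div_cancel₀ _ hκ]
  ring

end Aux

/-! ### The signed-slack thermodynamic-limit theorem -/

section Limit

/-- **Window certificate with a SIGNED energy slack ⇒ orbit-mean correlator bound for every
torus-limit ground state of the `t–t'` Hubbard model on `ℤ²`, at every filling.** Data exactly as in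
`IsTorusLimitOf.re_sum_expect_d4_ge_of_window_certificate_TT'_ineq` (objective `X ∈ 𝔄_{Λ'}`, density
multipliers `μ_σ`, `ν`, ONE energy term `κ (u·1 − Γ E^{tt'}_Φ)`, Han's constraint families, point-group
labels `γₗ ∈ S`), but instead of `κ ≥ 0` and `energyDensityTT' t t' U n ≤ u` only the signed slack
`0 ≤ κ (u − energyDensityTT' t t' U n)` is assumed — so a certificate may use a certified LOWER energy
bound (`κ ≤ 0`, `u ≤ e`) as well as an upper one. Conclusion:
`c − Σₖ ‖aₖ‖ + (Σ_σ μ_σ)(n/2 − ν) ≤ |S|⁻¹ Σ_{γ∈S} Re ω_{γΛ'}(Γ(d4Emb γ 0) X)`.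
Wang et al. 2024 §III eq. (obsopt) (both energy half-spaces); Han 2020 §3. [cite: WangEtAl2024, §III] -/
theorem InfVolFermionState.IsTorusLimitOf.re_sum_expect_d4_ge_of_window_certificate_TT'_ineq_of_slack
    (t t' : ℝ) {U : ℝ} (hU : 0 ≤ U) {n : ℝ} (hn0 : 0 ≤ n) (hn2 : n < 2) {κ u : ℝ}
    (hslack : 0 ≤ κ * (u - ThermodynamicLimit.energyDensityTT' t t' U n))
    {Λ Λ' : Finset (Site 2)} (hΛ : Λ ⊆ Λ') (h8 : thicken Λ 1 ⊆ Λ')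
    (h0 : thicken ({0} : Finset (Site 2)) 1 ⊆ Λ') (hz : (0 : Site 2) ∈ Λ')
    {S : Finset (DihedralGroup 4)} (h1 : (1 : DihedralGroup 4) ∈ S) (hmul : ∀ a ∈ S, ∀ b ∈ S, a * b ∈ S)
    (Xw : FermionOp Λ') (μ : Fin 2 → ℝ) (ν : ℝ)
    {m : Type*} [Fintype m] [DecidableEq m] {Λm : Matrix m m ℂ} (hΛm : Λm.PosSemidef)
    (O : m → FermionOp Λ')
    {κ' : Type*} (s : Finset κ') (B : κ' → FermionOp Λ)
    {ι : Type*} (tt : Finset ι) (γ : ι → DihedralGroup 4) (hγS : ∀ l ∈ tt, γ l ∈ S) (wv : ι → Site 2)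
    (hsh : ∀ l, d4ShiftSet (γ l) (wv l) Λ ⊆ Λ') (Y : ι → FermionOp Λ)
    {ρ : Type*} (uu : Finset ρ) (b : ρ → ℂ) (cw : ρ → List (Orb (PolySite Λ') × Bool))
    (hcw : ∀ j ∈ uu, ladderCharge (cw j) ≠ 0 ∨ ladderSpinCharge (cw j) ≠ 0)
    {δ : Type*} (ah : Finset δ) (dc : δ → ℝ) (V : δ → FermionOp Λ')
    {κ'' : Type*} (w : Finset κ'') (a : κ'' → ℂ) (word : κ'' → List (Orb (PolySite Λ') × Bool)) {c : ℝ}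
    (hcert : Xw - (c : ℂ) • (1 : FermionOp Λ') -
        ∑ σ : Fin 2, ((μ σ : ℝ) : ℂ) • (nAt 0 hz σ - ((ν : ℝ) : ℂ) • (1 : FermionOp Λ')) -
        ((κ : ℝ) : ℂ) • (((u : ℝ) : ℂ) • (1 : FermionOp Λ') -
          fermionEmbed (PolySite.incl h0) ((hubbardTTPrimeFermionInteraction t t' U).meanEnergyObs 1)) =
      gramForm Λm O +
        (∑ k ∈ s, ((hubbardTTPrimeFermionInteraction t t' U).localHamiltonian Λ' * fermionEmbed (PolySite.incl hΛ) (B k) -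
            fermionEmbed (PolySite.incl hΛ) (B k) * (hubbardTTPrimeFermionInteraction t t' U).localHamiltonian Λ') +
          ∑ l ∈ tt, (fermionEmbed (PolySite.incl (hsh l)) (fermionEmbed (PolySite.d4Emb (γ l) (wv l) Λ) (Y l)) -
            fermionEmbed (PolySite.incl hΛ) (Y l)) +
          ∑ j ∈ uu, b j • ladderWord (cw j)) +
        (∑ m' ∈ ah, ((dc m' : ℝ) : ℂ) • ((V m')ᴴ - V m') + ∑ k ∈ w, a k • ladderWord (word k)))
    {Ls : ℕ → ℕ} (hLs : Tendsto Ls atTop atTop)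
    {ψ : ∀ L, Fock (Orb (FermionTorus 2 L))}
    (hψ : ∀ j, IsGroundStateInSector (hubbardTorusTT' (Ls j) t t' U)
      (ThermodynamicLimit.rectN n (Ls j)) 0 (ψ (Ls j)))
    (hψ1 : ∀ j, star (ψ (Ls j)) ⬝ᵥ ψ (Ls j) = 1)
    {ω : InfVolFermionState 2} (hω : ω.IsTorusLimitOf ψ Ls) :
    c - ∑ k ∈ w, ‖a k‖ + (∑ σ : Fin 2, μ σ) * (n / 2 - ν) ≤
      (S.card : ℝ)⁻¹ * ∑ g ∈ S,
        (ω.expect (d4ShiftSet g 0 Λ') (fermionEmbed (PolySite.d4Emb g 0 Λ') Xw)).re := by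
  -- the averaged torus expectations of the rotated observables converge to their values in `ω`
  have hlim : Tendsto (fun j => (S.card : ℝ)⁻¹ * ∑ g ∈ S,
      (torusAvgExpect (Ls j) (d4ShiftSet g 0 Λ') (fermionEmbed (PolySite.d4Emb g 0 Λ') Xw) (ψ (Ls j))).re)
      atTop (𝓝 ((S.card : ℝ)⁻¹ * ∑ g ∈ S,
        (ω.expect (d4ShiftSet g 0 Λ') (fermionEmbed (PolySite.d4Emb g 0 Λ') Xw)).re)) := by
    refine (tendsto_finsetSum S fun g _ => ?_).const_mul _
    exact (Complex.continuous_re.tendsto _).comp (hω (d4ShiftSet g 0 Λ') _)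
  -- the energies per site converge to the thermodynamic-limit density, the fillings to `n/2`
  have hE : Tendsto (fun j => groundEnergy (hubbardTorusTT' (Ls j) t t' U) (ThermodynamicLimit.rectN n (Ls j)) /
      ((Ls j : ℕ) : ℝ) ^ 2) atTop (𝓝 (ThermodynamicLimit.energyDensityTT' t t' U n)) :=
    (ThermodynamicLimit.tendsto_energyDensityTT'_torus t t' hU hn0 hn2).comp hLs
  have hN : Tendsto (fun j => (ThermodynamicLimit.rectN n (Ls j) : ℝ) / 2 / ((Ls j : ℕ) : ℝ) ^ 2) atTop
      (𝓝 (n / 2)) := by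
    have h := ((ThermodynamicLimit.tendsto_rectN_div_sq hn0).comp hLs).div_const 2
    refine h.congr fun j => ?_
    simp only [Function.comp_apply]
    ring
  set b0 : ℝ := c - ∑ k ∈ w, ‖a k‖ with hb0
  have hbnd : Tendsto (fun j => b0 + (∑ σ : Fin 2, μ σ) *
      ((ThermodynamicLimit.rectN n (Ls j) : ℝ) / 2 / ((Ls j : ℕ) : ℝ) ^ 2 - ν) +
      κ * (u - groundEnergy (hubbardTorusTT' (Ls j) t t' U) (ThermodynamicLimit.rectN n (Ls j)) /
        ((Ls j : ℕ) : ℝ) ^ 2)) atTop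
      (𝓝 (b0 + (∑ σ : Fin 2, μ σ) * (n / 2 - ν) + κ * (u - ThermodynamicLimit.energyDensityTT' t t' U n))) :=
    (tendsto_const_nhds.add ((hN.sub_const ν).const_mul _)).add ((tendsto_const_nhds.sub hE).const_mul κ)
  -- the finite-torus inequality (signed slack kept) holds for all large `j`
  have hev' : ∀ᶠ j in atTop, b0 + (∑ σ : Fin 2, μ σ) *
      ((ThermodynamicLimit.rectN n (Ls j) : ℝ) / 2 / ((Ls j : ℕ) : ℝ) ^ 2 - ν) +
      κ * (u - groundEnergy (hubbardTorusTT' (Ls j) t t' U) (ThermodynamicLimit.rectN n (Ls j)) /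
        ((Ls j : ℕ) : ℝ) ^ 2) ≤
      (S.card : ℝ)⁻¹ * ∑ g ∈ S,
        (torusAvgExpect (Ls j) (d4ShiftSet g 0 Λ') (fermionEmbed (PolySite.d4Emb g 0 Λ') Xw) (ψ (Ls j))).re := by
    filter_upwards [eventually_injOn_proj_of_tendsto (thicken Λ' 1) hLs, hLs.eventually_ge_atTop 3]
      with j hInj hL3
    haveI : NeZero (Ls j) := ⟨by omega⟩
    have hInj' : Set.InjOn (Torus.proj (d := 2) (Ls j)) ↑Λ' :=
      hInj.mono (by exact_mod_cast subset_thicken Λ' 1)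
    -- the sector `(rectN n L, 0) = (2 nh, 0)`
    set nh : ℕ := ⌊n * ((Ls j : ℕ) : ℝ) ^ 2 / 2⌋₊ with hnh
    have hrect : ThermodynamicLimit.rectN n (Ls j) = 2 * nh := rfl
    have hn : nh ≤ Fintype.card (FermionTorus 2 (Ls j)) := half_rectN_le_card_fermionTorus hn0 hn2.le (Ls j)
    obtain ⟨hψK, -, hHψ⟩ := hψ j
    rw [hrect] at hψK hHψ
    rw [← groundEnergy_hubbardTorusTT'_eq_minEnergyOn_szSector (Ls j) t t' U hn] at hHψ
    have h := re_orbitState_ge_of_window_certificate_d4_TT'_ineq t t' U hL3 hΛ h8 h0 hz hInj hInj' h1 hmul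
      hψK (hψ1 j) hHψ Xw κ u μ ν hΛm O s B tt γ hγS wv hsh Y uu b cw hcw ah dc V w a word hcert
    rw [re_orbitState_spaceGroupUnitary_fermionEmbed_toTorusEmb S hInj'] at h
    have hcast : (nh : ℝ) = (ThermodynamicLimit.rectN n (Ls j) : ℝ) / 2 := by
      rw [hrect]; push_cast; ring
    rw [hcast, ← hrect] at h
    simp_rw [torusAvgExpect_eq]
    exact h
  have hle := le_of_tendsto_of_tendsto hbnd hlim hev'
  linarith

/-- **Translation-only certificates, signed energy slack ⇒ the correlator of every torus-limit
ground state.** Under the hypotheses of `…_TT'_ineq_of_slack` with all point-group labels trivial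
(`γₗ = 1`): `c − Σₖ ‖aₖ‖ + (Σ_σ μ_σ)(n/2 − ν) ≤ Re ω_{Λ'}(X)`.
Wang et al. 2024 §III eq. (obsopt); Han 2020 §3. [cite: WangEtAl2024, §III] -/
theorem InfVolFermionState.IsTorusLimitOf.re_expect_ge_of_window_certificate_TT'_ineq_of_slack
    (t t' : ℝ) {U : ℝ} (hU : 0 ≤ U) {n : ℝ} (hn0 : 0 ≤ n) (hn2 : n < 2) {κ u : ℝ}
    (hslack : 0 ≤ κ * (u - ThermodynamicLimit.energyDensityTT' t t' U n))
    {Λ Λ' : Finset (Site 2)} (hΛ : Λ ⊆ Λ') (h8 : thicken Λ 1 ⊆ Λ')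
    (h0 : thicken ({0} : Finset (Site 2)) 1 ⊆ Λ') (hz : (0 : Site 2) ∈ Λ')
    (Xw : FermionOp Λ') (μ : Fin 2 → ℝ) (ν : ℝ)
    {m : Type*} [Fintype m] [DecidableEq m] {Λm : Matrix m m ℂ} (hΛm : Λm.PosSemidef)
    (O : m → FermionOp Λ')
    {κ' : Type*} (s : Finset κ') (B : κ' → FermionOp Λ)
    {ι : Type*} (tt : Finset ι) (γ : ι → DihedralGroup 4) (hγ1 : ∀ l ∈ tt, γ l = 1) (wv : ι → Site 2)
    (hsh : ∀ l, d4ShiftSet (γ l) (wv l) Λ ⊆ Λ') (Y : ι → FermionOp Λ)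
    {ρ : Type*} (uu : Finset ρ) (b : ρ → ℂ) (cw : ρ → List (Orb (PolySite Λ') × Bool))
    (hcw : ∀ j ∈ uu, ladderCharge (cw j) ≠ 0 ∨ ladderSpinCharge (cw j) ≠ 0)
    {δ : Type*} (ah : Finset δ) (dc : δ → ℝ) (V : δ → FermionOp Λ')
    {κ'' : Type*} (w : Finset κ'') (a : κ'' → ℂ) (word : κ'' → List (Orb (PolySite Λ') × Bool)) {c : ℝ}
    (hcert : Xw - (c : ℂ) • (1 : FermionOp Λ') -
        ∑ σ : Fin 2, ((μ σ : ℝ) : ℂ) • (nAt 0 hz σ - ((ν : ℝ) : ℂ) • (1 : FermionOp Λ')) -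
        ((κ : ℝ) : ℂ) • (((u : ℝ) : ℂ) • (1 : FermionOp Λ') -
          fermionEmbed (PolySite.incl h0) ((hubbardTTPrimeFermionInteraction t t' U).meanEnergyObs 1)) =
      gramForm Λm O +
        (∑ k ∈ s, ((hubbardTTPrimeFermionInteraction t t' U).localHamiltonian Λ' * fermionEmbed (PolySite.incl hΛ) (B k) -
            fermionEmbed (PolySite.incl hΛ) (B k) * (hubbardTTPrimeFermionInteraction t t' U).localHamiltonian Λ') +
          ∑ l ∈ tt, (fermionEmbed (PolySite.incl (hsh l)) (fermionEmbed (PolySite.d4Emb (γ l) (wv l) Λ) (Y l)) -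
            fermionEmbed (PolySite.incl hΛ) (Y l)) +
          ∑ j ∈ uu, b j • ladderWord (cw j)) +
        (∑ m' ∈ ah, ((dc m' : ℝ) : ℂ) • ((V m')ᴴ - V m') + ∑ k ∈ w, a k • ladderWord (word k)))
    {Ls : ℕ → ℕ} (hLs : Tendsto Ls atTop atTop)
    {ψ : ∀ L, Fock (Orb (FermionTorus 2 L))}
    (hψ : ∀ j, IsGroundStateInSector (hubbardTorusTT' (Ls j) t t' U)
      (ThermodynamicLimit.rectN n (Ls j)) 0 (ψ (Ls j)))
    (hψ1 : ∀ j, star (ψ (Ls j)) ⬝ᵥ ψ (Ls j) = 1)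
    {ω : InfVolFermionState 2} (hω : ω.IsTorusLimitOf ψ Ls) :
    c - ∑ k ∈ w, ‖a k‖ + (∑ σ : Fin 2, μ σ) * (n / 2 - ν) ≤ (ω.expect Λ' Xw).re := by
  have h1 : (1 : DihedralGroup 4) ∈ ({1} : Finset (DihedralGroup 4)) := Finset.mem_singleton_self 1
  have hmul : ∀ a ∈ ({1} : Finset (DihedralGroup 4)), ∀ b ∈ ({1} : Finset (DihedralGroup 4)),
      a * b ∈ ({1} : Finset (DihedralGroup 4)) := by
    intro a ha b hb
    rw [Finset.mem_singleton] at ha hb ⊢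
    rw [ha, hb, mul_one]
  have hγS : ∀ l ∈ tt, γ l ∈ ({1} : Finset (DihedralGroup 4)) := fun l hl =>
    Finset.mem_singleton.2 (hγ1 l hl)
  have h := hω.re_sum_expect_d4_ge_of_window_certificate_TT'_ineq_of_slack t t' hU hn0 hn2 hslack hΛ h8 h0 hz
    h1 hmul Xw μ ν hΛm O s B tt γ hγS wv hsh Y uu b cw hcw ah dc V w a word hcert hLs hψ hψ1
  rwa [Finset.sum_singleton, Finset.card_singleton, Nat.cast_one, inv_one, one_mul,
    ω.expect_fermionEmbed_d4Emb_one_zero] at h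

end Limit

/-! ### The two-multiplier form (certified window `lo ≤ e₀ ≤ hi`, as printed) -/

section Window

/-- **Window certificate with BOTH energy half-spaces ⇒ orbit-mean correlator bound for every
torus-limit ground state.** Data as in `…_TT'_ineq_of_slack` except that the energy part of the
identity is `κ₊ (hi·1 − Γ E^{tt'}_Φ) + κ₋ (Γ E^{tt'}_Φ − lo·1)` with `κ₊, κ₋ ≥ 0`, and the certified
thermodynamic-limit window `lo ≤ energyDensityTT' t t' U n ≤ hi` is assumed. Conclusion:
`c − Σₖ ‖aₖ‖ + (Σ_σ μ_σ)(n/2 − ν) ≤ |S|⁻¹ Σ_{γ∈S} Re ω_{γΛ'}(Γ(d4Emb γ 0) X)`.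
(Collapse to one signed term, `smul_window_collapse`, `window_collapse_slack`; the case `κ₊ = κ₋`
leaves the nonnegative constant `κ₊ (hi − lo)`.) Wang et al. 2024 §III eq. (obsopt): "⟨ψ|E↑ − H|ψ⟩ ≥ 0
and ⟨ψ|H − E↓|ψ⟩ ≥ 0 … can be added as additional constraints". [cite: WangEtAl2024, §III] -/
theorem InfVolFermionState.IsTorusLimitOf.re_sum_expect_d4_ge_of_window_certificate_TT'_ineq_of_window
    (t t' : ℝ) {U : ℝ} (hU : 0 ≤ U) {n : ℝ} (hn0 : 0 ≤ n) (hn2 : n < 2) {κp κm lo hi : ℝ}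
    (hκp : 0 ≤ κp) (hκm : 0 ≤ κm)
    (hlo : lo ≤ ThermodynamicLimit.energyDensityTT' t t' U n)
    (hhi : ThermodynamicLimit.energyDensityTT' t t' U n ≤ hi)
    {Λ Λ' : Finset (Site 2)} (hΛ : Λ ⊆ Λ') (h8 : thicken Λ 1 ⊆ Λ')
    (h0 : thicken ({0} : Finset (Site 2)) 1 ⊆ Λ') (hz : (0 : Site 2) ∈ Λ')
    {S : Finset (DihedralGroup 4)} (h1 : (1 : DihedralGroup 4) ∈ S) (hmul : ∀ a ∈ S, ∀ b ∈ S, a * b ∈ S)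
    (Xw : FermionOp Λ') (μ : Fin 2 → ℝ) (ν : ℝ)
    {m : Type*} [Fintype m] [DecidableEq m] {Λm : Matrix m m ℂ} (hΛm : Λm.PosSemidef)
    (O : m → FermionOp Λ')
    {κ' : Type*} (s : Finset κ') (B : κ' → FermionOp Λ)
    {ι : Type*} (tt : Finset ι) (γ : ι → DihedralGroup 4) (hγS : ∀ l ∈ tt, γ l ∈ S) (wv : ι → Site 2)
    (hsh : ∀ l, d4ShiftSet (γ l) (wv l) Λ ⊆ Λ') (Y : ι → FermionOp Λ)
    {ρ : Type*} (uu : Finset ρ) (b : ρ → ℂ) (cw : ρ → List (Orb (PolySite Λ') × Bool))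
    (hcw : ∀ j ∈ uu, ladderCharge (cw j) ≠ 0 ∨ ladderSpinCharge (cw j) ≠ 0)
    {δ : Type*} (ah : Finset δ) (dc : δ → ℝ) (V : δ → FermionOp Λ')
    {κ'' : Type*} (w : Finset κ'') (a : κ'' → ℂ) (word : κ'' → List (Orb (PolySite Λ') × Bool)) {c : ℝ}
    (hcert : Xw - (c : ℂ) • (1 : FermionOp Λ') -
        ∑ σ : Fin 2, ((μ σ : ℝ) : ℂ) • (nAt 0 hz σ - ((ν : ℝ) : ℂ) • (1 : FermionOp Λ')) -
        ((κp : ℝ) : ℂ) • (((hi : ℝ) : ℂ) • (1 : FermionOp Λ') -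
          fermionEmbed (PolySite.incl h0) ((hubbardTTPrimeFermionInteraction t t' U).meanEnergyObs 1)) -
        ((κm : ℝ) : ℂ) • (fermionEmbed (PolySite.incl h0) ((hubbardTTPrimeFermionInteraction t t' U).meanEnergyObs 1) -
          ((lo : ℝ) : ℂ) • (1 : FermionOp Λ')) =
      gramForm Λm O +
        (∑ k ∈ s, ((hubbardTTPrimeFermionInteraction t t' U).localHamiltonian Λ' * fermionEmbed (PolySite.incl hΛ) (B k) -
            fermionEmbed (PolySite.incl hΛ) (B k) * (hubbardTTPrimeFermionInteraction t t' U).localHamiltonian Λ') +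
          ∑ l ∈ tt, (fermionEmbed (PolySite.incl (hsh l)) (fermionEmbed (PolySite.d4Emb (γ l) (wv l) Λ) (Y l)) -
            fermionEmbed (PolySite.incl hΛ) (Y l)) +
          ∑ j ∈ uu, b j • ladderWord (cw j)) +
        (∑ m' ∈ ah, ((dc m' : ℝ) : ℂ) • ((V m')ᴴ - V m') + ∑ k ∈ w, a k • ladderWord (word k)))
    {Ls : ℕ → ℕ} (hLs : Tendsto Ls atTop atTop)
    {ψ : ∀ L, Fock (Orb (FermionTorus 2 L))}
    (hψ : ∀ j, IsGroundStateInSector (hubbardTorusTT' (Ls j) t t' U)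
      (ThermodynamicLimit.rectN n (Ls j)) 0 (ψ (Ls j)))
    (hψ1 : ∀ j, star (ψ (Ls j)) ⬝ᵥ ψ (Ls j) = 1)
    {ω : InfVolFermionState 2} (hω : ω.IsTorusLimitOf ψ Ls) :
    c - ∑ k ∈ w, ‖a k‖ + (∑ σ : Fin 2, μ σ) * (n / 2 - ν) ≤
      (S.card : ℝ)⁻¹ * ∑ g ∈ S,
        (ω.expect (d4ShiftSet g 0 Λ') (fermionEmbed (PolySite.d4Emb g 0 Λ') Xw)).re := by
  set E : FermionOp Λ' :=
    fermionEmbed (PolySite.incl h0) ((hubbardTTPrimeFermionInteraction t t' U).meanEnergyObs 1) with hE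
  set e : ℝ := ThermodynamicLimit.energyDensityTT' t t' U n with he
  by_cases hne : κp = κm
  · -- the energy operator drops; the constant `κp (hi - lo) ≥ 0` is absorbed into `c`
    subst hne
    have hconst : 0 ≤ κp * (hi - lo) := mul_nonneg hκp (by linarith)
    have key : Xw - (((c + κp * (hi - lo) : ℝ)) : ℂ) • (1 : FermionOp Λ') -
        ∑ σ : Fin 2, ((μ σ : ℝ) : ℂ) • (nAt 0 hz σ - ((ν : ℝ) : ℂ) • (1 : FermionOp Λ')) -
        (((0 : ℝ)) : ℂ) • ((((0 : ℝ)) : ℂ) • (1 : FermionOp Λ') - E) =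
      Xw - (c : ℂ) • (1 : FermionOp Λ') -
        ∑ σ : Fin 2, ((μ σ : ℝ) : ℂ) • (nAt 0 hz σ - ((ν : ℝ) : ℂ) • (1 : FermionOp Λ')) -
        ((κp : ℝ) : ℂ) • (((hi : ℝ) : ℂ) • (1 : FermionOp Λ') - E) -
        ((κp : ℝ) : ℂ) • (E - ((lo : ℝ) : ℂ) • (1 : FermionOp Λ')) := by
      push_cast
      module
    have hcert' := key.trans hcert
    have hslack : 0 ≤ (0 : ℝ) * ((0 : ℝ) - ThermodynamicLimit.energyDensityTT' t t' U n) := by simp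
    have h := hω.re_sum_expect_d4_ge_of_window_certificate_TT'_ineq_of_slack t t' hU hn0 hn2 hslack hΛ h8 h0 hz
      h1 hmul Xw μ ν hΛm O s B tt γ hγS wv hsh Y uu b cw hcw ah dc V w a word hcert' hLs hψ hψ1
    linarith
  · -- collapse to one signed term `κ (u·1 − E)`, `κ = κp − κm`, `κ u = κp hi − κm lo`
    have key : Xw - (c : ℂ) • (1 : FermionOp Λ') -
        ∑ σ : Fin 2, ((μ σ : ℝ) : ℂ) • (nAt 0 hz σ - ((ν : ℝ) : ℂ) • (1 : FermionOp Λ')) -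
        (((κp - κm : ℝ)) : ℂ) • (((((κp * hi - κm * lo) / (κp - κm) : ℝ)) : ℂ) • (1 : FermionOp Λ') - E) =
      Xw - (c : ℂ) • (1 : FermionOp Λ') -
        ∑ σ : Fin 2, ((μ σ : ℝ) : ℂ) • (nAt 0 hz σ - ((ν : ℝ) : ℂ) • (1 : FermionOp Λ')) -
        ((κp : ℝ) : ℂ) • (((hi : ℝ) : ℂ) • (1 : FermionOp Λ') - E) -
        ((κm : ℝ) : ℂ) • (E - ((lo : ℝ) : ℂ) • (1 : FermionOp Λ')) := by
      rw [smul_window_collapse (1 : FermionOp Λ') E hi lo hne]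
      abel
    have hcert' := key.trans hcert
    have hslack : 0 ≤ (κp - κm) * ((κp * hi - κm * lo) / (κp - κm) - ThermodynamicLimit.energyDensityTT' t t' U n) := by
      rw [window_collapse_slack hi lo _ hne]
      exact add_nonneg (mul_nonneg hκp (sub_nonneg.2 hhi)) (mul_nonneg hκm (sub_nonneg.2 hlo))
    exact hω.re_sum_expect_d4_ge_of_window_certificate_TT'_ineq_of_slack t t' hU hn0 hn2 hslack hΛ h8 h0 hz
      h1 hmul Xw μ ν hΛm O s B tt γ hγS wv hsh Y uu b cw hcw ah dc V w a word hcert' hLs hψ hψ1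

/-- **Translation-only certificates with both energy half-spaces ⇒ the correlator of every
torus-limit ground state**: under the hypotheses of `…_TT'_ineq_of_window` with all `γₗ = 1`,
`c − Σₖ ‖aₖ‖ + (Σ_σ μ_σ)(n/2 − ν) ≤ Re ω_{Λ'}(X)`. The shape consumed by the venture's two-sided
thermodynamic-limit correlator rows. [cite: WangEtAl2024, §III] -/
theorem InfVolFermionState.IsTorusLimitOf.re_expect_ge_of_window_certificate_TT'_ineq_of_window
    (t t' : ℝ) {U : ℝ} (hU : 0 ≤ U) {n : ℝ} (hn0 : 0 ≤ n) (hn2 : n < 2) {κp κm lo hi : ℝ}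
    (hκp : 0 ≤ κp) (hκm : 0 ≤ κm)
    (hlo : lo ≤ ThermodynamicLimit.energyDensityTT' t t' U n)
    (hhi : ThermodynamicLimit.energyDensityTT' t t' U n ≤ hi)
    {Λ Λ' : Finset (Site 2)} (hΛ : Λ ⊆ Λ') (h8 : thicken Λ 1 ⊆ Λ')
    (h0 : thicken ({0} : Finset (Site 2)) 1 ⊆ Λ') (hz : (0 : Site 2) ∈ Λ')
    (Xw : FermionOp Λ') (μ : Fin 2 → ℝ) (ν : ℝ)
    {m : Type*} [Fintype m] [DecidableEq m] {Λm : Matrix m m ℂ} (hΛm : Λm.PosSemidef)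
    (O : m → FermionOp Λ')
    {κ' : Type*} (s : Finset κ') (B : κ' → FermionOp Λ)
    {ι : Type*} (tt : Finset ι) (γ : ι → DihedralGroup 4) (hγ1 : ∀ l ∈ tt, γ l = 1) (wv : ι → Site 2)
    (hsh : ∀ l, d4ShiftSet (γ l) (wv l) Λ ⊆ Λ') (Y : ι → FermionOp Λ)
    {ρ : Type*} (uu : Finset ρ) (b : ρ → ℂ) (cw : ρ → List (Orb (PolySite Λ') × Bool))
    (hcw : ∀ j ∈ uu, ladderCharge (cw j) ≠ 0 ∨ ladderSpinCharge (cw j) ≠ 0)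
    {δ : Type*} (ah : Finset δ) (dc : δ → ℝ) (V : δ → FermionOp Λ')
    {κ'' : Type*} (w : Finset κ'') (a : κ'' → ℂ) (word : κ'' → List (Orb (PolySite Λ') × Bool)) {c : ℝ}
    (hcert : Xw - (c : ℂ) • (1 : FermionOp Λ') -
        ∑ σ : Fin 2, ((μ σ : ℝ) : ℂ) • (nAt 0 hz σ - ((ν : ℝ) : ℂ) • (1 : FermionOp Λ')) -
        ((κp : ℝ) : ℂ) • (((hi : ℝ) : ℂ) • (1 : FermionOp Λ') -
          fermionEmbed (PolySite.incl h0) ((hubbardTTPrimeFermionInteraction t t' U).meanEnergyObs 1)) -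
        ((κm : ℝ) : ℂ) • (fermionEmbed (PolySite.incl h0) ((hubbardTTPrimeFermionInteraction t t' U).meanEnergyObs 1) -
          ((lo : ℝ) : ℂ) • (1 : FermionOp Λ')) =
      gramForm Λm O +
        (∑ k ∈ s, ((hubbardTTPrimeFermionInteraction t t' U).localHamiltonian Λ' * fermionEmbed (PolySite.incl hΛ) (B k) -
            fermionEmbed (PolySite.incl hΛ) (B k) * (hubbardTTPrimeFermionInteraction t t' U).localHamiltonian Λ') +
          ∑ l ∈ tt, (fermionEmbed (PolySite.incl (hsh l)) (fermionEmbed (PolySite.d4Emb (γ l) (wv l) Λ) (Y l)) -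
            fermionEmbed (PolySite.incl hΛ) (Y l)) +
          ∑ j ∈ uu, b j • ladderWord (cw j)) +
        (∑ m' ∈ ah, ((dc m' : ℝ) : ℂ) • ((V m')ᴴ - V m') + ∑ k ∈ w, a k • ladderWord (word k)))
    {Ls : ℕ → ℕ} (hLs : Tendsto Ls atTop atTop)
    {ψ : ∀ L, Fock (Orb (FermionTorus 2 L))}
    (hψ : ∀ j, IsGroundStateInSector (hubbardTorusTT' (Ls j) t t' U)
      (ThermodynamicLimit.rectN n (Ls j)) 0 (ψ (Ls j)))
    (hψ1 : ∀ j, star (ψ (Ls j)) ⬝ᵥ ψ (Ls j) = 1)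
    {ω : InfVolFermionState 2} (hω : ω.IsTorusLimitOf ψ Ls) :
    c - ∑ k ∈ w, ‖a k‖ + (∑ σ : Fin 2, μ σ) * (n / 2 - ν) ≤ (ω.expect Λ' Xw).re := by
  have h1 : (1 : DihedralGroup 4) ∈ ({1} : Finset (DihedralGroup 4)) := Finset.mem_singleton_self 1
  have hmul : ∀ a ∈ ({1} : Finset (DihedralGroup 4)), ∀ b ∈ ({1} : Finset (DihedralGroup 4)),
      a * b ∈ ({1} : Finset (DihedralGroup 4)) := by
    intro a ha b hb
    rw [Finset.mem_singleton] at ha hb ⊢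
    rw [ha, hb, mul_one]
  have hγS : ∀ l ∈ tt, γ l ∈ ({1} : Finset (DihedralGroup 4)) := fun l hl =>
    Finset.mem_singleton.2 (hγ1 l hl)
  have h := hω.re_sum_expect_d4_ge_of_window_certificate_TT'_ineq_of_window t t' hU hn0 hn2 hκp hκm hlo hhi
    hΛ h8 h0 hz h1 hmul Xw μ ν hΛm O s B tt γ hγS wv hsh Y uu b cw hcw ah dc V w a word hcert hLs hψ hψ1
  rwa [Finset.sum_singleton, Finset.card_singleton, Nat.cast_one, inv_one, one_mul,
    ω.expect_fermionEmbed_d4Emb_one_zero] at h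

end Window

end Literature.MathematicalPhysics.QuantumLattice

end
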